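import Summits.QuantumFields.BalabanUV.Beta.D1BFx.LandauDictionaryHWeighted
import Literature.MathematicalPhysics.QuantumFieldTheory.Balaban1983to89.Beta.BiLaplaceBlockKKT

/-!
# Road BF-x, slot (K) dictionary brick B7 (DICT-Γ), part 1: A FORCE DRIVES THE SUPERPOSED COLUMN `Ga v` CORRECTED BY THE PURE GAUGE TERM
# `−(c∕r)·d(𝔅(δv))` — `SolvesKKT n (c•v) (𝒬(Ga v)) (Ga v − (c∕r)•d𝔅δv) (−a′•𝒬(Ga v)) (−(r n²)•G′R(δ(Ga v)))` from X₁a ALONE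
# (`𝔅 = BiLaplaceBlockKKT.Sb`, finitely supported force; the weighted X₁a of the owner's ruling ρ-g5-5)

HONEST DEPENDENCY (page 1, mandatory): continuum YM on T⁴ ⇐ BetaPertH ∧ nine spine estimates (0/9 proved); BetaPertH ⇐ (D1) ∧ (D4) ∧
CAP+tail; G-an2-4 gates asym, D1 and NE2/3/4.  HONEST FRAMING (cell contract, verbatim): «discharging `BetaPertH` makes Bałaban's UV
stability UNCONDITIONAL — a real constructive-QFT result; it is NOT the continuum limit and NOT the Clay problem.»  THIS MODULE is [folklore]
assembly BY NAME over my B6 (`LandauDictionaryHWeighted.el_superposed_w`, `LandauDictionaryHOps`), B3∕B4∕B5 and an2's `BiLaplaceBlockKKT`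
(`Sb_EL`, `Sb_M`, `decay_Sb`); no `def`, no `def … : Prop`, nothing cited, 0 sorry.  X₁a is a DISPLAYED HYPOTHESIS (the owner's `X1-SPEC.md`);
NOTHING says it holds.  The read-out of (D-Γ) `Gam = c⁻¹·(Γ_R − (c∕r)·d∘𝔅∘δ)` by uniqueness against the block-average-killing column is part 2.
0∕4 binders of row D1 (hW, hR, D1Tel, D1Rep) discharged; NOT D1, NOT BetaPertH, NOT continuum, NOT Clay.

ABSOLUTE RULE (cell charter, verbatim): «No internally-minted statement may enter as a cited fact. Every hypothesis is either kernel-proved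
in this package or a verbatim quotation of a PUBLISHED theorem with page reference. The manuscript(s) under audit are NOT citable for their
own disputed steps — they are the thing under adjudication; programme-internal (2001/route/tribunal) claims are never citable.»

WHY THE CORRECTION (K-R1-SPEC v2 §2 (D-Γ); `DICT-BRICKS.md` row B7).  Superposing X₁a against a FORCE `v` (instead of a coarse weight) gives
`S(Ga v) = c•v − r•d(RδA₁) − a′•𝒬ᵀ𝒬A₁`, `A₁ := Ga v`; applying `δ` shows `Δ₀δA₁ = Δ₀PδA₁ + (block-constant) + (c∕r)·δv` — NOT block-constant:
the gauge condition (G) fails by exactly `(c∕r)·δv`.  The pure gauge field `d χ`, `χ := 𝔅(δv) = Σ_{x′} (δv)(x′)·Sb(·,x′)` (finite sum), has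
`S(dχ) = 0`, `𝒬(dχ) = d̄(blockSum χ) = 0` (`Sb_M`) and `Δ₀²χ = δv + (block-constant)` (`Sb_EL`), so `A := A₁ − (c∕r)•dχ` repairs (G) and changes
nothing else.

CONTENT.
* §1 finite superposition of the bi-Laplacian kernel: `lapN_finsum`, `blockSum_finsum`, `chi_lapLap` (`Δ₀²χ = ψ + bc`), `blockSum_chi`,
  `contourSum_dz_chi` (`= 0`), `curvAdj_curv_sub_smul_dz`, bounds `abs_dz_chi_le`, `abs_finsum_ite`.
* §2 **`solvesKKT_force_w`** and **`tempered_force_w`**.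
Unit `b2b-balaban-beta-d1-formalise-leaf-06` (gen 6), 2026-08-20; `DICT-BRICKS.md` row B7; CLAIM «DICT-B7» (journal).
-/

namespace Summit.QuantumFields.BalabanUV.Beta.D1BFx.LandauDictionaryGamma

open Finset
open scoped BigOperators
open Literature.MathematicalPhysics.QuantumFieldTheory.Balaban1983to89
open Literature.MathematicalPhysics.QuantumFieldTheory.Balaban1983to89.Beta
open ExpKernelCalculus (Site MKer Decays Zl Zl_nonneg)
open B12Sec2to5 (l1 l1_nonneg)
open AffineAveraging (Form0 Form1 box toSite unitVec dz curv curvAdj codiff₁ blockSum contourSum curv_dz contourSum_dz)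
open AffineReproduction (contourSumAdj IsBlockConst codiff₁_sub dz_sub dz_add contourSum_sub)
open KKTFluctuationKernel (delta1 delta1_apply)
open KKTFluctuationEnergy (quo_zsmul_add_toSite)
open KKTFluctuationUnique (SolvesKKT Tempered0 Tempered1)
open KernelSpecInstance (codiff₁_smul dz_smul curv_add curv_smul contourSum_smul codiff₁_add)
open ResolventComposition (codiff₁_curvAdj isBlockConst_codiff₁_contourSumAdj)
open Literature.MathematicalPhysics.QuantumFieldTheory.LatticeForm (quo)
open BiLaplaceBlockKKT (Sb Wb Sb_EL Sb_M decay_Sb)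
open Summit.QuantumFields.BalabanUV.Beta.TameKernelCalculus (Spr)
open KernelFormOperators (kerOp kerOp₁ Pf Rf Rf_eq abs_kerOp₁_le bound_nonneg)
open TowerEquationForms (Gf)
open ProjectorGaugeBlockConst (isBlockConst_codiff₁_dz_Pf)
open LandauDictionaryHOps (abs_codiff₁_le_of_bound codiff₁_dz_neg_sq_Gf_Rf blockSum_neg_sq_Gf_Rf exists_bound_neg_sq_Gf_Rf)
open LandauDictionaryH (isBlockConst_comb)
open LandauDictionaryHWeighted (el_superposed_w)

noncomputable section

variable (n : ℕ) [NeZero n]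

/-! ## §1 The finite bi-Laplacian superposition `χ := Σ_{x′ ∈ S} ψ x′ · Sb(·, x′)` -/

section Chi

/-- [folklore] `Δ₀ = codiff₁ ∘ dz` through a finite superposition of 0-forms. -/
theorem lapN_finsum (S : Finset (Site 4)) (c : Site 4 → ℝ) (g : Site 4 → Form0 4 ℝ) :
    codiff₁ (dz (fun p => ∑ x' ∈ S, c x' * g x' p)) = fun x => ∑ x' ∈ S, c x' * codiff₁ (dz (g x')) x := by
  classical
  induction S using Finset.induction_on with
  | empty =>
    funext x
    simp [AffineAveraging.codiff₁, AffineAveraging.dz]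
  | insert x' S hx' ih =>
    funext x
    have e : (fun p => ∑ y ∈ insert x' S, c y * g y p) = (c x' • g x') + fun p => ∑ y ∈ S, c y * g y p := by
      funext p; rw [Finset.sum_insert hx']; rfl
    rw [e, dz_add, codiff₁_add, Pi.add_apply, dz_smul, codiff₁_smul, Pi.smul_apply, smul_eq_mul, ih, Finset.sum_insert hx']

omit [NeZero n] in
/-- [folklore] Block sums through a finite superposition of 0-forms. -/
theorem blockSum_finsum (S : Finset (Site 4)) (c : Site 4 → ℝ) (g : Site 4 → Form0 4 ℝ) (y : Site 4) :
    blockSum n (fun p => ∑ x' ∈ S, c x' * g x' p) y = ∑ x' ∈ S, c x' * blockSum n (g x') y := by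
  simp only [AffineAveraging.blockSum, Finset.mul_sum]
  rw [Finset.sum_comm]

/-- [folklore] **`Δ₀²χ = ψ + (block-constant)`** for `χ := Σ_{x′ ∈ S} ψ x′·Sb(·,x′)` and `ψ` supported in `S` (`BiLaplaceBlockKKT.Sb_EL`). -/
theorem chi_lapLap (S : Finset (Site 4)) (ψ : Form0 4 ℝ) (hS : ∀ x ∉ S, ψ x = 0) (x : Site 4) :
    codiff₁ (dz (codiff₁ (dz (fun p => ∑ x' ∈ S, ψ x' * Sb (N := n) p x')))) x
      = ψ x + ∑ x' ∈ S, ψ x' * Wb (N := n) (quo n x) x' := by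
  classical
  rw [lapN_finsum, lapN_finsum]
  simp only [Sb_EL, mul_add, Finset.sum_add_distrib]
  rw [add_comm]
  congr 1
  by_cases hx : x ∈ S
  · rw [Finset.sum_eq_single x (fun y _ hy => by rw [if_neg (fun h : x = y => hy h.symm), mul_zero]) (fun h => absurd hx h),
      if_pos rfl, mul_one]
  · rw [hS x hx]
    refine Finset.sum_eq_zero fun y hy => ?_
    rw [if_neg, mul_zero]
    rintro rfl
    exact hx hy

/-- [folklore] The block-constant part IS block-constant (`quo n` of a box point is its block index). -/
theorem isBlockConst_chi_corr (S : Finset (Site 4)) (ψ : Form0 4 ℝ) :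
    IsBlockConst n (fun x => ∑ x' ∈ S, ψ x' * Wb (N := n) (quo n x) x') := by
  intro y b hb
  simp only [quo_zsmul_add_toSite (N := n) y hb, ResolventComposition.quo_zsmul' (N := n) y]

/-- [folklore] `χ` has zero block sums (`Sb_M`). -/
theorem blockSum_chi (S : Finset (Site 4)) (ψ : Form0 4 ℝ) (y : Site 4) :
    blockSum n (fun p => ∑ x' ∈ S, ψ x' * Sb (N := n) p x') y = 0 := by
  rw [blockSum_finsum]
  exact Finset.sum_eq_zero fun x' _ => by rw [Sb_M, mul_zero]

/-- [folklore] **`𝒬(dχ) = 0`**: `contourSum n (dz χ) = dz (blockSum n χ) = 0` (`contourSum_dz` + `Sb_M`). -/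
theorem contourSum_dz_chi (S : Finset (Site 4)) (ψ : Form0 4 ℝ) (κ : Fin 4) (y : Site 4) :
    contourSum n (dz (fun p => ∑ x' ∈ S, ψ x' * Sb (N := n) p x')) κ y = 0 := by
  rw [contourSum_dz]
  simp only [AffineAveraging.dz, blockSum_chi, sub_self]

/-- [folklore] `S(A₁ − k•dχ) = S A₁` pointwise (`curv ∘ dz = 0`). -/
theorem curvAdj_curv_sub_smul_dz (A₁ : Form1 4 ℝ) (k : ℝ) (χ : Form0 4 ℝ) :
    curvAdj (curv (A₁ - k • dz χ)) = curvAdj (curv A₁) := by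
  rw [sub_eq_add_neg, ← neg_smul, curv_add, curv_smul, curv_dz, smul_zero, add_zero]

/-- [folklore] `d χ` is bounded: `|dz χ κ x| ≤ 2·C·Σ_{x′ ∈ S} |ψ x′|` when `|Sb| ≤ C`. -/
theorem abs_dz_chi_le (S : Finset (Site 4)) (ψ : Form0 4 ℝ) {C : ℝ} (hC : ∀ x x' : Site 4, |Sb (N := n) x x'| ≤ C) (κ : Fin 4) (x : Site 4) :
    |dz (fun p => ∑ x' ∈ S, ψ x' * Sb (N := n) p x') κ x| ≤ 2 * C * ∑ x' ∈ S, |ψ x'| := by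
  simp only [AffineAveraging.dz]
  have hsum : ∀ p, |∑ x' ∈ S, ψ x' * Sb (N := n) p x'| ≤ C * ∑ x' ∈ S, |ψ x'| := fun p => by
    rw [Finset.mul_sum]
    refine (Finset.abs_sum_le_sum_abs _ _).trans (Finset.sum_le_sum fun x' _ => ?_)
    rw [abs_mul, mul_comm]
    exact mul_le_mul_of_nonneg_right (hC p x') (abs_nonneg _)
  calc |(∑ x' ∈ S, ψ x' * Sb (N := n) (x + unitVec κ) x') - ∑ x' ∈ S, ψ x' * Sb (N := n) x x'|
      ≤ |∑ x' ∈ S, ψ x' * Sb (N := n) (x + unitVec κ) x'| + |∑ x' ∈ S, ψ x' * Sb (N := n) x x'| := abs_sub _ _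
    _ ≤ C * ∑ x' ∈ S, |ψ x'| + C * ∑ x' ∈ S, |ψ x'| := add_le_add (hsum _) (hsum _)
    _ = 2 * C * ∑ x' ∈ S, |ψ x'| := by ring

end Chi

/-! ## §2 The force-driven candidate solves the typed KKT system (weighted X₁a, finitely supported force, `r ≠ 0`) -/

section Solves

variable (a : ℝ) {r a' c : ℝ} {Ga : MKer 4 (Fin 4)} {C δ Mv : ℝ} {v : Form1 4 ℝ}

/-- [folklore] **BRICK B7, GENERAL FORM: THE FORCE-DRIVEN COLUMN WITH ITS BI-LAPLACIAN GAUGE CORRECTION SOLVES THE TYPED KKT SYSTEM.**  For a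
decaying vector kernel `Ga` whose columns satisfy the weighted X₁a (`r ≠ 0`), a bounded force `v` whose codifferential `ψ := codiff₁ v` is
supported in a finite set `S`, with `A₁ := kerOp₁ Ga v`, `χ := Σ_{x′ ∈ S} ψ x′·Sb(·,x′)`:
`SolvesKKT n (c•v) (𝒬A₁) (A₁ − (c∕r)•dχ) (−a′•𝒬A₁) (−(r·n²)•G′R(δA₁))`. -/
theorem solvesKKT_force_w (ha : 0 < a) (hr : r ≠ 0) (hGa : Decays Ga C δ) (hδ : 0 < δ) (hv : ∀ κ x, |v κ x| ≤ Mv)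
    (S : Finset (Site 4)) (hS : ∀ x ∉ S, codiff₁ v x = 0)
    (hX1a : ∀ (m : Fin 4) (z : Site 4) (κ : Fin 4) (x : Site 4),
      curvAdj (curv (fun κ' p => Ga p z κ' m)) κ x = c * delta1 m z κ x - r * dz (Rf n a (codiff₁ (fun κ' p => Ga p z κ' m))) κ x
        - a' * contourSumAdj n (contourSum n (fun κ' p => Ga p z κ' m)) κ x) :
    SolvesKKT n (c • v) (contourSum n (kerOp₁ Ga v))
      (kerOp₁ Ga v - (c / r) • dz (fun p => ∑ x' ∈ S, codiff₁ v x' * Sb (N := n) p x'))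
      (fun κ y => -(a' * contourSum n (kerOp₁ Ga v) κ y))
      (fun p => -(r * (n : ℝ) ^ 2) * Gf n a (Rf n a (codiff₁ (kerOp₁ Ga v))) p) := by
  set A₁ : Form1 4 ℝ := kerOp₁ Ga v with hA₁def
  set χ : Form0 4 ℝ := fun p => ∑ x' ∈ S, codiff₁ v x' * Sb (N := n) p x' with hχdef
  have hA₁ : ∀ κ x, |A₁ κ x| ≤ 4 * C * Zl 4 δ * Mv := fun κ x => abs_kerOp₁_le hGa hδ hv κ x
  set g : Form0 4 ℝ := codiff₁ A₁ with hgdef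
  have hg : ∀ q, |g q| ≤ 8 * (4 * C * Zl 4 δ * Mv) := fun q => abs_codiff₁_le_of_bound hA₁ q
  -- (E1) for the force-driven superposition
  have hE1 : ∀ κ x, curvAdj (curv A₁) κ x = c * v κ x - r * dz (Rf n a g) κ x - a' * contourSumAdj n (contourSum n A₁) κ x :=
    fun κ x => el_superposed_w n a ha hGa hδ hv hX1a κ x
  -- the weighted multiplier
  have hμr : (fun p => -(r * (n : ℝ) ^ 2) * Gf n a (Rf n a g) p) = r • (fun p => -((n : ℝ) ^ 2) * Gf n a (Rf n a g) p) := by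
    funext p; simp only [Pi.smul_apply, smul_eq_mul]; ring
  have hΔμ : codiff₁ (dz (fun p => -(r * (n : ℝ) ^ 2) * Gf n a (Rf n a g) p)) = fun p => -(r * Rf n a g p) := by
    rw [hμr, dz_smul, codiff₁_smul]
    funext p
    rw [Pi.smul_apply, smul_eq_mul, codiff₁_dz_neg_sq_Gf_Rf n a ha hg p]
    ring
  have hφ : ∀ κ x, contourSumAdj n (fun κ y => -(a' * contourSum n A₁ κ y)) κ x = -(a' * contourSumAdj n (contourSum n A₁) κ x) := by
    intro κ x
    simp only [AffineReproduction.contourSumAdj, Finset.mul_sum, Finset.sum_neg_distrib]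
  refine ⟨fun κ x => ?_, ?_, fun y => ?_, fun κ y => ?_⟩
  · -- (el): the gauge correction is invisible to `S`
    rw [curvAdj_curv_sub_smul_dz, hΔμ, hφ, Pi.smul_apply, Pi.smul_apply, smul_eq_mul]
    have hneg : dz (fun p => -(r * Rf n a g p)) κ x = -(r * dz (Rf n a g) κ x) := by
      simp only [AffineAveraging.dz]; ring
    rw [hneg, hE1 κ x]
    ring
  · -- (gauge): `Δ₀δA = Δ₀δA₁ − (c/r)Δ₀²χ`, `Δ₀δA₁ = Δ₀PδA₁ + bc + (c/r)ψ`, `Δ₀²χ = ψ + bc′`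
    have hfun : curvAdj (curv A₁) = c • v - r • dz (Rf n a g) - a' • contourSumAdj n (contourSum n A₁) := by
      funext κ x
      simp only [Pi.sub_apply, Pi.smul_apply, smul_eq_mul]
      exact hE1 κ x
    have h0 := congrArg codiff₁ hfun
    rw [codiff₁_curvAdj, codiff₁_sub, codiff₁_sub, codiff₁_smul, codiff₁_smul, codiff₁_smul] at h0
    have hR : codiff₁ (dz (Rf n a g)) = codiff₁ (dz g) - codiff₁ (dz (Pf n a g)) := by
      rw [Rf_eq, dz_sub, codiff₁_sub]
      rfl
    rw [hR] at h0
    have hsol₁ : codiff₁ (dz g) = fun y => codiff₁ (dz (Pf n a g)) y + (c / r) * codiff₁ v y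
        - (a' / r) * codiff₁ (contourSumAdj n (contourSum n A₁)) y := by
      funext y
      have := congr_fun h0 y
      simp only [Pi.zero_apply, Pi.sub_apply, Pi.smul_apply, smul_eq_mul] at this
      field_simp
      linarith
    -- the gauge quantity of `A`
    have hδA : codiff₁ (A₁ - (c / r) • dz χ) = g - (c / r) • codiff₁ (dz χ) := by
      rw [codiff₁_sub, codiff₁_smul]
    have hχ2 : codiff₁ (dz (codiff₁ (dz χ))) = fun x => codiff₁ v x + ∑ x' ∈ S, codiff₁ v x' * Wb (N := n) (quo n x) x' :=
      funext fun x => chi_lapLap n S (codiff₁ v) hS x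
    show IsBlockConst n (codiff₁ (dz (codiff₁ (A₁ - (c / r) • dz χ))))
    rw [hδA, dz_sub, codiff₁_sub, dz_smul, codiff₁_smul, hχ2, hsol₁]
    have hcomb : ((fun y => codiff₁ (dz (Pf n a g)) y + (c / r) * codiff₁ v y - (a' / r) * codiff₁ (contourSumAdj n (contourSum n A₁)) y)
        - (c / r) • (fun x => codiff₁ v x + ∑ x' ∈ S, codiff₁ v x' * Wb (N := n) (quo n x) x'))
        = fun y => codiff₁ (dz (Pf n a g)) y + (-(c / r)) * (∑ x' ∈ S, codiff₁ v x' * Wb (N := n) (quo n y) x')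
          - (a' / r) * codiff₁ (contourSumAdj n (contourSum n A₁)) y := by
      funext y
      simp only [Pi.sub_apply, Pi.smul_apply, smul_eq_mul]
      ring
    rw [hcomb]
    refine isBlockConst_comb n ?_ ?_ ?_ (-(c / r)) (a' / r)
    · exact isBlockConst_codiff₁_dz_Pf n a ha hg
    · exact isBlockConst_chi_corr n S (codiff₁ v)
    · exact isBlockConst_codiff₁_contourSumAdj (N := n) _
  · -- (mean)
    rw [hμr]
    have h0 := blockSum_neg_sq_Gf_Rf n a ha hg y
    simp only [AffineAveraging.blockSum, Pi.smul_apply, smul_eq_mul] at h0 ⊢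
    rw [← Finset.mul_sum, h0, mul_zero]
  · -- (avg): `𝒬(dχ) = 0`
    rw [contourSum_sub, contourSum_smul, Pi.sub_apply, Pi.smul_apply, Pi.sub_apply, Pi.smul_apply, smul_eq_mul,
      contourSum_dz_chi, mul_zero, sub_zero]

/-- [folklore] **THE FORCE-DRIVEN TRIPLE IS TEMPERED** (bounded). -/
theorem tempered_force_w (ha : 0 < a) (hGa : Decays Ga C δ) (hδ : 0 < δ) (hv : ∀ κ x, |v κ x| ≤ Mv) (S : Finset (Site 4)) :
    Tempered1 (kerOp₁ Ga v - (c / r) • dz (fun p => ∑ x' ∈ S, codiff₁ v x' * Sb (N := n) p x'))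
      ∧ Tempered1 (fun κ y => -(a' * contourSum n (kerOp₁ Ga v) κ y))
      ∧ Tempered0 (fun p => -(r * (n : ℝ) ^ 2) * Gf n a (Rf n a (codiff₁ (kerOp₁ Ga v))) p) := by
  obtain ⟨δS, CS, hδS, hCS, hSb⟩ := decay_Sb (N := n) (d := 3)
  have hSbC : ∀ x x' : Site 4, |Sb (N := n) x x'| ≤ CS := fun x x' => (hSb x x').trans (by
    have h1 : Real.exp (-δS * l1 (x - x')) ≤ 1 := by rw [Real.exp_le_one_iff]; nlinarith [l1_nonneg (x - x')]
    nlinarith)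
  have hA₁ : ∀ κ x, |kerOp₁ Ga v κ x| ≤ 4 * C * Zl 4 δ * Mv := fun κ x => abs_kerOp₁_le hGa hδ hv κ x
  have hg : ∀ q, |codiff₁ (kerOp₁ Ga v) q| ≤ 8 * (4 * C * Zl 4 δ * Mv) := fun q => abs_codiff₁_le_of_bound hA₁ q
  have hχ : ∀ κ x, |dz (fun p => ∑ x' ∈ S, codiff₁ v x' * Sb (N := n) p x') κ x| ≤ 2 * CS * ∑ x' ∈ S, |codiff₁ v x'| :=
    fun κ x => abs_dz_chi_le n S (codiff₁ v) hSbC κ x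
  obtain ⟨B', hB'⟩ := exists_bound_neg_sq_Gf_Rf n a ha hg
  refine ⟨Tempered1.of_bounded (B := 4 * C * Zl 4 δ * Mv + |c / r| * (2 * CS * ∑ x' ∈ S, |codiff₁ v x'|)) fun κ x => ?_,
    Tempered1.of_bounded (B := |a'| * (((n : ℝ) ^ 4 * n) * (4 * C * Zl 4 δ * Mv))) fun κ y => ?_,
    Tempered0.of_bounded (B := |r| * B') fun p => ?_⟩
  · simp only [Pi.sub_apply, Pi.smul_apply, smul_eq_mul]
    refine (abs_sub _ _).trans (add_le_add (hA₁ κ x) ?_)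
    rw [abs_mul]
    exact mul_le_mul_of_nonneg_left (hχ κ x) (abs_nonneg _)
  · rw [abs_neg, abs_mul]
    refine mul_le_mul_of_nonneg_left ?_ (abs_nonneg a')
    simp only [AffineAveraging.contourSum]
    have hcard : (box 4 n).card = n ^ 4 := by
      simp only [AffineAveraging.box, Fintype.card_piFinset, Finset.card_range, Finset.prod_const, Finset.card_univ, Fintype.card_fin]
    calc |∑ bb ∈ box 4 n, ∑ s ∈ Finset.range n, kerOp₁ Ga v κ ((n : ℤ) • y + toSite bb + (s : ℤ) • unitVec κ)|
        ≤ ∑ bb ∈ box 4 n, ∑ s ∈ Finset.range n, |kerOp₁ Ga v κ ((n : ℤ) • y + toSite bb + (s : ℤ) • unitVec κ)| :=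
          (Finset.abs_sum_le_sum_abs _ _).trans (Finset.sum_le_sum fun bb _ => Finset.abs_sum_le_sum_abs _ _)
      _ ≤ ∑ bb ∈ box 4 n, ∑ _s ∈ Finset.range n, 4 * C * Zl 4 δ * Mv := Finset.sum_le_sum fun bb _ => Finset.sum_le_sum fun s _ => hA₁ _ _
      _ = ((n : ℝ) ^ 4 * n) * (4 * C * Zl 4 δ * Mv) := by
          rw [Finset.sum_const, Finset.sum_const, Finset.card_range, hcard, nsmul_eq_mul, nsmul_eq_mul]; push_cast; ring
  · have h := hB' p
    rw [show -(r * (n : ℝ) ^ 2) * Gf n a (Rf n a (codiff₁ (kerOp₁ Ga v))) p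
      = r * (-((n : ℝ) ^ 2) * Gf n a (Rf n a (codiff₁ (kerOp₁ Ga v))) p) by ring, abs_mul]
    exact mul_le_mul_of_nonneg_left h (abs_nonneg r)

end Solves

end

end Summit.QuantumFields.BalabanUV.Beta.D1BFx.LandauDictionaryGamma
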